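/-
Copyright: rh-split cell (screw, prover seat l19) gen 0, 2026-08-27.  Splitting search over kernel-typed
RH-equivalences.  A splitting `A ∧ B ⟹ RH` is CONDITIONAL bookkeeping unless `A` and `B` are both
proved; nothing here bears on the truth of RH.
-/
import Summits.RiemannHypothesis.RiemannHypothesis.Theorems.Splittings.ScrewLassoOriginFlux
import Summits.RiemannHypothesis.RiemannHypothesis.Theses.ScrewLasso
import HarnessLib

/-!
# Route X-13 `ScrewLasso` — item `LassoFlux` PROVED (RH-free), the route decl by name

Substance: `ScrewLassoFlux.lassoFlux_of_latticeCeiling` (file `ScrewLassoOriginFlux.lean`): under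
`CEIL(h)`, `h > 0`, if origin-centred circles of radii `→ 1⁻` lie in the component of `0` in `𝔻 ∖ T_h`,
then the total aliased charge `∑_ρ discWeight (c_ρ) (u_ρ) 0 1` vanishes (flux through each circle is `0`
by Cauchy + the identity theorem + termwise integration; radius `→ 1⁻` by Tannery).  The route decl
`Theses.ScrewLasso.LassoFlux` is that statement verbatim.

RH is not proved by this: `LassoFlux` is one RH-free leg of the CONDITIONAL splitting X-13
`LassoFlux ∧ ChargeContinuity ∧ LassoFine ∧ CeilAll ⟹ RH` (`LassoFine`, `CeilAll` open conjectures).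
No `sorry`, no new axioms, no instances, no notation.
-/

set_option linter.dupNamespace false

namespace Summit.RiemannHypothesis.RiemannHypothesis.Theorems.Splittings.ScrewLassoFlux

/-- **Item `LassoFlux` of route `ScrewLasso` (X-13) — PROVED** (the route decl by name; RH-free). -/
theorem lassoFlux_proof :
    Summit.RiemannHypothesis.RiemannHypothesis.Theses.ScrewLasso.LassoFlux :=
  fun _ hh hceil hlasso ↦ lassoFlux_of_latticeCeiling hh hceil hlasso

end Summit.RiemannHypothesis.RiemannHypothesis.Theorems.Splittings.ScrewLassoFlux
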